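import Literature.MathematicalPhysics.QuantumFieldTheory.Balaban1983to89.B3AttachAllCountertermsDegree

/-!
# `Balaban1983to89.B3AttachNestedCounterterms` — T. Bałaban, *(Higgs)₂,₃ quantum fields in a finite volume. III. Renormalization*,
Commun. Math. Phys. **88** (1983) 411–445 [Balaban1983Higgs3]: **(2.3)** p. 423 as the INDUCTIVE DEFINITION it is stated to be —
nested mass renormalization counterterms (counterterm graphs whose own mass renormalization vertices carry counterterm graphs, to any
depth), the recursively defined degree, the fully attached graph, and the sentence after (2.3) for it — on the model

statement-level skeleton of published theorems with citation tags; proofs where landed; nothing here is a claim about the Yang–Mills mass gap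

PDF held: `paper:balaban1983-higgs-2-3-quantum-fields-finite-volume` (journal page = PDF page + 410); text `lit read` p. 13 (p. 423).
CITATION HEADER (lean-in-tree rule).  lit-balaban TYPED SKELETON (HOME `run/shared/lean/pub/lit-balaban/`), Phase 2, seat p18 (gen 5),
unit `lit-balaban-p18`: SKELETON row **B3.Eq2.2-2.3** (owner r15; decl of record `B3Sect2Statements.graphDegree`).  p. 423 [PDF 13],
verbatim: *"If we have a counterterm from δm_k², then it corresponds to some graph G₀ and we define a degree of this counterterm as the
degree of the graph G₀. This is given by (2.2) if the assumption stated before this definition is satisfied. In the general case we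
take the following definition, which in fact is an inductive definition: D(G) = Σ_{v∈G} D_G(v) − d + (a sum of degrees of mass
renormalization counterterms connected with the vertices of the graph G). (2.3) Thus the degree of G is the same as the degree of a
graph G′ obtained from G by attaching the corresponding graphs to the mass renormalization vertices."*

WHAT IS FORMALISED (sorry-free, axioms standard; defs with bodies, no `Prop` fact), on top of the one-level simultaneous attachment
`B3AttachAllCounterterms.AttachAll.attachAll` and its degree identity `B3AttachAllCountertermsDegree.deg_attachAll`:
* `DTree nbar n` — a counterterm graph G₀ (with its attachment legs, `CTGraph`) DECORATED, at a set of its own mass renormalization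
  vertices, by decorated counterterm graphs, nesting depth n (the inductive datum of (2.3));
* `DTree.deg23` — the degree of a counterterm read off (2.3) recursively: D(G₀) = D_{(2.2)}(G₀) + Σ (degrees of the counterterms at
  its vertices);
* `Stage n G` — a graph G of the model (an `IGraph` over any finite vertex type) with decorated counterterm graphs of depth n at a set S
  of its (1.7)-vertices; `Stage.deg23` = (2.3) for G: D(G) + Σ_{v∈S} deg23(tree at v) (= r15's `graphDegree` with these counterterm
  degrees, `graphDegree23_eq_stageDeg23`);
* `flatten n st` — the graph obtained by attaching ALL the counterterm graphs, level by level (`Stage.next` re-reads the decorations of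
  the inserted graphs as decorations of the attached graph), down to the innermost ones;
* **`deg_flatten`**: the (2.2)-degree of the fully attached graph equals the recursively defined (2.3)-degree — the printed sentence
  for nested counterterms of any depth.
-/

namespace Literature.MathematicalPhysics.QuantumFieldTheory.Balaban1983to89.B3AttachNestedCounterterms

open Finset B3Prop1 B3Sect2Statements B3VertexBridge B3Cor23Concrete B3OddVectorLoops B3IGraph B3AttachCounterterm
  B3AttachCountertermDegree B3AttachAllCounterterms B3AttachAllCountertermsDegree B3Sect3LowestOrderGraphs B3Sect1Graphs122

variable {nbar : ℕ}

/-! ## Decorated counterterm graphs (the inductive datum of (2.3)) -/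

/-- A counterterm graph G₀ decorated, to nesting depth `n`, by counterterm graphs at a set of its own mass renormalization vertices
(depth 0: no decoration; depth n+1: at each vertex of `S` a decorated counterterm graph of depth n) — the inductive datum of the
*"inductive definition"* (2.3). [cite: Balaban1983Higgs3, (2.3) p.423] -/
inductive DTree (nbar : ℕ) : ℕ → Type
  | base (C : CTGraph nbar) : DTree nbar 0
  | node {n : ℕ} (C : CTGraph nbar) (S : Finset (Fin C.H.nV)) (hv : ∀ a : S, C.H.kind a.1 = .v17)
      (child : S → DTree nbar n) : DTree nbar (n + 1)

namespace DTree

/-- The counterterm graph at the root of a decorated counterterm graph. [cite: Balaban1983Higgs3, (2.3) p.423] -/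
def top : {n : ℕ} → DTree nbar n → CTGraph nbar
  | _, base C => C
  | _, node C _ _ _ => C

/-- The decorated mass renormalization vertices of the root. [cite: Balaban1983Higgs3, (2.3) p.423] -/
def sites : {n : ℕ} → (t : DTree nbar (n + 1)) → Finset (Fin t.top.H.nV)
  | _, node _ S _ _ => S

/-- kernel: they are vertices (1.7). [cite: Balaban1983Higgs3, (1.7) p.413] -/
theorem sites_v17 : {n : ℕ} → (t : DTree nbar (n + 1)) → ∀ a : t.sites, t.top.H.kind a.1 = .v17
  | _, node _ _ hv _ => hv

/-- The decorations (decorated counterterm graphs of depth one less). [cite: Balaban1983Higgs3, (2.3) p.423] -/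
def child : {n : ℕ} → (t : DTree nbar (n + 1)) → t.sites → DTree nbar n
  | _, node _ _ _ c => c

/-- **(2.3) read recursively** for a counterterm: *"we define a degree of this counterterm as the degree of the graph G₀"*, the
latter by (2.3) again — D(G₀) = D_{(2.2)}(G₀) + Σ (degrees of the counterterms at the vertices of G₀).
[cite: Balaban1983Higgs3, (2.3) p.423] -/
def deg23 (d : ℕ) : (n : ℕ) → DTree nbar n → ℚ
  | 0, base C => C.H.deg d
  | n + 1, node C S _ c => C.H.deg d + ∑ a : S, deg23 d n (c a)

/-- kernel: depth 0 — the degree of an undecorated counterterm graph is its (2.2)-degree. [cite: Balaban1983Higgs3, (2.2) p.423] -/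
theorem deg23_zero (d : ℕ) (t : DTree nbar 0) : t.deg23 d 0 = t.top.H.deg d := by
  cases t; rfl

/-- kernel: the recursion of (2.3) through the accessors. [cite: Balaban1983Higgs3, (2.3) p.423] -/
theorem deg23_succ (d : ℕ) {n : ℕ} (t : DTree nbar (n + 1)) :
    t.deg23 d (n + 1) = t.top.H.deg d + ∑ a : t.sites, (t.child a).deg23 d n := by
  cases t; rfl

end DTree

/-! ## A graph with decorated counterterms at its mass renormalization vertices -/

/-- A graph G of the model (over any finite vertex type) together with decorated counterterm graphs of depth `n` at a finite set `S`
of its mass renormalization vertices. [cite: Balaban1983Higgs3, (2.3) p.423] -/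
structure Stage (nbar n : ℕ) {ι : Type} (G : IGraph nbar ι) where
  /-- the mass renormalization vertices carrying counterterms from δm²_k -/
  S : Finset ι
  /-- they are vertices (1.7) -/
  hv : ∀ a : S, G.kind a.1 = .v17
  /-- their decorated counterterm graphs -/
  child : S → DTree nbar n

namespace Stage

variable {n : ℕ} {ι : Type} [Fintype ι] [DecidableEq ι] {G : IGraph nbar ι}

/-- The one-level attachment data: the root counterterm graphs. [cite: Balaban1983Higgs3, (2.3) p.423] -/
def toAttachAll (st : Stage nbar n G) : AttachAll G := ⟨st.S, st.hv, fun a => (st.child a).top⟩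

/-- **(2.3)** for G with nested counterterms: D(G) = Σ_v D_G(v) − d + Σ_{v∈S} (the recursively defined degree of the counterterm at
v). [cite: Balaban1983Higgs3, (2.3) p.423] -/
def deg23 (d : ℕ) (st : Stage nbar n G) : ℚ := G.deg d + ∑ a : st.S, (st.child a).deg23 d n

/-- kernel: `Stage.deg23` is r15's (2.3) `B3Sect2Statements.graphDegree` of G with the counterterm degrees `DTree.deg23` on S
(0 elsewhere). [cite: Balaban1983Higgs3, (2.3) p.423] -/
theorem graphDegree23_eq_stageDeg23 (d : ℕ) (st : Stage nbar n G) :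
    graphDegree d univ
        (fun i => (⟨toCounts d (G.kind i),
          ⟨G.intScalar i, G.intVector i, G.intDiffs i, G.intScalar_le i, G.intVector_le i, G.intDiffs_le i⟩,
          if h : i ∈ st.S then (st.child ⟨i, h⟩).deg23 d n else 0⟩ : GraphVertex)) =
      st.deg23 d :=
  graphDegree_ctDeg (G := G) d st.S fun a => (st.child a).deg23 d n

/-! ### One level down: the decorations of the inserted graphs, re-read on the attached graph -/

/-- Which vertices of the attached graph carry the next level of counterterms: the decorated vertices of the inserted counterterm
graphs. [cite: Balaban1983Higgs3, (2.3) p.423] -/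
def NextP (st : Stage nbar (n + 1) G) : ({w : ι // w ∉ st.toAttachAll.S} ⊕ (Σ a : st.toAttachAll.S, Fin (st.toAttachAll.H a).nV)) → Prop
  | Sum.inl _ => False
  | Sum.inr q => q.2 ∈ (st.child q.1).sites

/-- kernel: carrying a next-level counterterm is decidable. [cite: Balaban1983Higgs3, (2.3) p.423] -/
instance (st : Stage nbar (n + 1) G) : DecidablePred st.NextP := fun p =>
  match p with
  | Sum.inl _ => inferInstanceAs (Decidable False)
  | Sum.inr q => inferInstanceAs (Decidable (q.2 ∈ (st.child q.1).sites))

/-- The next stage: the attached graph G′ (all root counterterm graphs inserted) with the decorations of the inserted graphs as its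
own decorations, of depth one less. [cite: Balaban1983Higgs3, (2.3) p.423] -/
def next (st : Stage nbar (n + 1) G) : Stage nbar n st.toAttachAll.attachAll where
  S := univ.filter st.NextP
  hv p := match p with
    | ⟨Sum.inr q, h⟩ => (st.child q.1).sites_v17 ⟨q.2, (mem_filter.mp h).2⟩
    | ⟨Sum.inl _, h⟩ => False.elim (mem_filter.mp h).2
  child p := match p with
    | ⟨Sum.inr q, h⟩ => (st.child q.1).child ⟨q.2, (mem_filter.mp h).2⟩
    | ⟨Sum.inl _, h⟩ => False.elim (mem_filter.mp h).2

/-- kernel: the decorated vertices of the next stage are the pairs (v ∈ S, decorated vertex of the counterterm graph at v).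
[cite: Balaban1983Higgs3, (2.3) p.423] -/
def nextEquiv (st : Stage nbar (n + 1) G) : (Σ a : st.S, ((st.child a).sites : Type)) ≃ (st.next.S : Type) where
  toFun q := ⟨Sum.inr ⟨q.1, q.2.1⟩, mem_filter.mpr ⟨mem_univ _, q.2.2⟩⟩
  invFun p := match p with
    | ⟨Sum.inr q, h⟩ => ⟨q.1, ⟨q.2, (mem_filter.mp h).2⟩⟩
    | ⟨Sum.inl _, h⟩ => False.elim (mem_filter.mp h).2
  left_inv _ := rfl
  right_inv p := match p with
    | ⟨Sum.inr _, _⟩ => rfl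
    | ⟨Sum.inl _, h⟩ => False.elim (mem_filter.mp h).2

/-- kernel: the decoration re-read on the attached graph is the original one. [cite: Balaban1983Higgs3, (2.3) p.423] -/
theorem next_child (st : Stage nbar (n + 1) G) (q : Σ a : st.S, ((st.child a).sites : Type)) :
    st.next.child (st.nextEquiv q) = (st.child q.1).child q.2 := rfl

/-- kernel: (2.3) is stable under passing to the next stage — D(G) + Σ_{v∈S} deg23(tree_v) = D(G′) + Σ (deg23 of the remaining
decorations), G′ the attached graph (`deg_attachAll` + the recursion `DTree.deg23_succ`). [cite: Balaban1983Higgs3, (2.3) p.423] -/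
theorem deg23_next (d : ℕ) (st : Stage nbar (n + 1) G) : st.next.deg23 d = st.deg23 d := by
  unfold deg23
  rw [deg_attachAll, ← Fintype.sum_equiv st.nextEquiv (fun q => ((st.child q.1).child q.2).deg23 d n)
      (fun p => (st.next.child p).deg23 d n) (fun q => by rw [next_child]), Fintype.sum_sigma, add_assoc]
  show G.deg d + ((∑ a : st.S, (st.child a).top.H.deg d) + ∑ a : st.S, ∑ b : (st.child a).sites, ((st.child a).child b).deg23 d n) =
    G.deg d + ∑ a : st.S, (st.child a).deg23 d (n + 1)
  rw [← sum_add_distrib]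
  exact congrArg _ (sum_congr rfl fun a _ => ((st.child a).deg23_succ d).symm)

end Stage

/-! ## The fully attached graph and its degree -/

/-- A graph of the model over SOME finite vertex type (the output of the iterated attachment). [cite: Balaban1983Higgs3, (2.3) p.423] -/
structure Flat (nbar : ℕ) : Type 1 where
  /-- the vertex type -/
  κ : Type
  /-- it is finite -/
  instF : Fintype κ
  /-- with decidable equality -/
  instD : DecidableEq κ
  /-- the graph -/
  G : IGraph nbar κ

/-- The (2.2)-degree of the packaged graph. [cite: Balaban1983Higgs3, (2.2) p.423] -/
def Flat.deg (F : Flat nbar) (d : ℕ) : ℚ :=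
  letI := F.instF; letI := F.instD; F.G.deg d

/-- **The graph G′ "obtained from G by attaching the corresponding graphs to the mass renormalization vertices"**, p. 423, for NESTED
counterterms: attach the root counterterm graphs at all of S at once, then the counterterm graphs decorating the inserted graphs, and
so on down to depth 0. [cite: Balaban1983Higgs3, (2.3) p.423] -/
def flatten : (n : ℕ) → {ι : Type} → [Fintype ι] → [DecidableEq ι] → {G : IGraph nbar ι} → Stage nbar n G → Flat nbar
  | 0, _, _, _, _, st => ⟨_, inferInstance, inferInstance, st.toAttachAll.attachAll⟩
  | _ + 1, _, _, _, _, st => flatten _ st.next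

/-- **p. 423, (2.3) as an inductive definition and the sentence after it** — *"In the general case we take the following definition,
which in fact is an inductive definition: D(G) = Σ_{v∈G} D_G(v) − d + (a sum of degrees of mass renormalization counterterms connected
with the vertices of the graph G). (2.3) Thus the degree of G is the same as the degree of a graph G′ obtained from G by attaching the
corresponding graphs to the mass renormalization vertices."* — PROVED on the model for counterterm graphs nested to any depth: the
(2.2)-degree of the fully attached graph `flatten n st` equals the recursively defined (2.3)-degree `Stage.deg23`.
[cite: Balaban1983Higgs3, (2.3) p.423] -/
theorem deg_flatten (d : ℕ) : (n : ℕ) → {ι : Type} → [Fintype ι] → [DecidableEq ι] → {G : IGraph nbar ι} →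
    (st : Stage nbar n G) → (flatten n st).deg d = st.deg23 d
  | 0, _, _, _, _, st => by
    show st.toAttachAll.attachAll.deg d = _
    rw [deg_attachAll, Stage.deg23]
    exact congrArg _ (sum_congr rfl fun a _ => ((st.child a).deg23_zero d).symm)
  | n + 1, _, _, _, _, st => by
    show (flatten n st.next).deg d = _
    rw [deg_flatten d n st.next, Stage.deg23_next]

/-- The printed sentence in r15's notation: (2.3) `B3Sect2Statements.graphDegree` of G, the counterterm at each v ∈ S having the degree
of its (decorated) graph G₀ defined inductively by (2.3), equals the (2.2)-degree of the fully attached graph.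
[cite: Balaban1983Higgs3, (2.3) p.423] -/
theorem graphDegree23_eq_deg_flatten (d n : ℕ) {ι : Type} [Fintype ι] [DecidableEq ι] {G : IGraph nbar ι} (st : Stage nbar n G) :
    graphDegree d univ
        (fun i => (⟨toCounts d (G.kind i),
          ⟨G.intScalar i, G.intVector i, G.intDiffs i, G.intScalar_le i, G.intVector_le i, G.intDiffs_le i⟩,
          if h : i ∈ st.S then (st.child ⟨i, h⟩).deg23 d n else 0⟩ : GraphVertex)) =
      (flatten n st).deg d := by
  rw [deg_flatten, Stage.graphDegree23_eq_stageDeg23]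

/-! ## Example: a depth-1 decoration (the Dyson chain inside the Dyson chain) -/

/-- The n = 2 Dyson chain `dyson2` as a counterterm graph: its two external φ′-legs (leg 0 of the first vertex, leg 1 of the second)
are the attachment legs (vertices (1.7) carry no differentiation). [cite: Balaban1983Higgs3, (1.21) p.416] -/
def dyson2CT (nbar : ℕ) : CTGraph nbar where
  H := dyson2 nbar
  x k := ⟨⟨k.1, k.2⟩, ⟨k.1, k.2⟩⟩
  x_inj a b h := by
    have := congrArg (fun y : SLeg (dyson2 nbar) => (y.1 : ℕ)) h
    exact Fin.ext (by simpa using this)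
  ext k := by fin_cases k <;> rfl
  undiff _ _ := rfl

/-- A depth-1 decorated counterterm: the chain `dyson2` whose two (1.7)-vertices both carry the (undecorated) counterterm graph
(1.22)④ `g36a`. [cite: Balaban1983Higgs3, (2.3) p.423] -/
def chainTree (hn : 1 ≤ nbar) : DTree nbar 1 :=
  .node (dyson2CT nbar) univ (fun _ => rfl)
    fun _ => .base ⟨g36a nbar hn, (attach1239 hn).x, (attach1239 hn).x_inj, (attach1239 hn).ext, (attach1239 hn).undiff⟩

/-- kernel: its recursively defined degree is D(dyson2) + 2·D(g36a) = 2 + 2(2 − d) = 6 − 2d. [cite: Balaban1983Higgs3, (2.3) p.423] -/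
theorem chainTree_deg23 (d : ℕ) (hn : 1 ≤ nbar) : (chainTree hn).deg23 d 1 = 6 - 2 * (d : ℚ) := by
  rw [DTree.deg23_succ]
  show (dyson2 nbar).deg d + ∑ _a : (univ : Finset (Fin 2)), (g36a nbar hn).deg d = _
  rw [dyson2_deg, Finset.sum_const, Finset.card_univ, Fintype.card_coe, Finset.card_univ, Fintype.card_fin, g36a_deg]
  simp only [nsmul_eq_mul, Nat.cast_ofNat]
  ring

/-- The chain `dyson2` with, at BOTH of its mass renormalization vertices, the depth-1 decorated chain `chainTree` (counterterm
graphs inside counterterm graphs). [cite: Balaban1983Higgs3, (2.3) p.423] -/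
def nestedStage (hn : 1 ≤ nbar) : Stage nbar 1 (toIGraph (dyson2 nbar)) where
  S := univ
  hv _ := rfl
  child _ := chainTree hn

/-- kernel: the (2.3)-degree of the nested example is D(dyson2) + 2·(6 − 2d) = 14 − 4d … [cite: Balaban1983Higgs3, (2.3) p.423] -/
theorem nestedStage_deg23 (d : ℕ) (hn : 1 ≤ nbar) : (nestedStage hn).deg23 d = 14 - 4 * (d : ℚ) := by
  unfold Stage.deg23
  show (toIGraph (dyson2 nbar)).deg d + ∑ _a : (univ : Finset (Fin 2)), (chainTree hn).deg23 d 1 = _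
  rw [deg_toIGraph, dyson2_deg, Finset.sum_const, Finset.card_univ, Fintype.card_coe, Finset.card_univ, Fintype.card_fin,
    chainTree_deg23]
  simp only [nsmul_eq_mul, Nat.cast_ofNat]
  ring

/-- … and it IS the (2.2)-degree of the graph obtained by attaching everything (two levels, six counterterm graphs in all).
[cite: Balaban1983Higgs3, (2.3) p.423] -/
theorem deg_flatten_nestedStage (d : ℕ) (hn : 1 ≤ nbar) : (flatten 1 (nestedStage hn)).deg d = 14 - 4 * (d : ℚ) := by
  rw [deg_flatten, nestedStage_deg23]

end Literature.MathematicalPhysics.QuantumFieldTheory.Balaban1983to89.B3AttachNestedCounterterms
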